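import Mathlib.Analysis.Calculus.IteratedDeriv.Lemmas
import Literature.Analysis.FluidPDE.TypeIAncientMild
import Literature.Analysis.FluidPDE.KNSSLocalSmoothingHolds
import Literature.Analysis.FluidPDE.OseenMildUniqueness
import Literature.Analysis.FluidPDE.WeakSolution
import HarnessLib

/-!
# Universal window bounds on `∂ₜu`, `∂ₜ²u` for Type-I KNSS-mild ancient fields
# (route `ClockStretchingLaw`, crux `ClockLaw`, stmt-NavierStokesRegularity-10571, line `birth`,
# stub `stub_timeDerivBounds`)

For every Type-I constant `C` and every compact time window `[a, b] ⊂ (-∞, 0)` there is ONE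
constant `K = K(C, b)` such that every Type-I KNSS-mild ancient field `u`
(`IsTypeIAncientMild C u`: jointly smooth on `(-∞,0) × ℝ³`, divergence free, solving the Oseen
integral equation `u(t) = e^{(t-s)Δ}u(s) - B¹_s(u,u)(t)` between all `s < t < 0`, with
`‖u(t,x)‖ ≤ C/√(-t)`) satisfies `‖∂ₜu(t,x)‖ ≤ K` and `‖∂ₜ²u(t,x)‖ ≤ K` for all `t ∈ [a,b]` and
all `x` (`stub_timeDerivBounds`). This is Koch–Nadirashvili–Seregin–Šverák 2009, Prop. 4.1 /
(4.5) ("`t^{k/2+l} ∇ᵏ∂ₜˡ u` bounded by `C(k,l)‖u₀‖_∞` on `(0, ε(k,l)‖u₀‖_∞^{-2})`") in its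
quantitative local form, restarted along the ancient field.

Proof (`exists_uniform_bound_iteratedDeriv_slice`, any order `l`, as in
`analyticOnNhd_uncurry_of_oseenMild` of `ClockStretchingLawSteadySliceLiouvilleAnalytic.lean`).
Let `ε, C₀` be the universal constants of the proved local fact
`knss2009_local_smoothing_holds` for `(k, l) = (0, l)`. On `(-∞, b/2]` every field of the class is
bounded by `M = C/√(-b/2) + 1`; put `h = min (ε/M²) (-b/4)`. For `t ≤ b` restart at
`s = t - h/2`: the local smooth solution `v` from the datum `u(s)` lives on `(s, s + ε/M²) ⊇ (s, s+h)`,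
obeys `(τ - s)ˡ ‖∂ₜˡ v(τ, x)‖ ≤ C₀ M`, and coincides with `u` on `(s, s + h) ∋ t` by uniqueness of
bounded solutions of the Oseen integral equation (`oseenMild_bounded_unique`) and continuity of the
slices. Hence `‖∂ₜˡ u(t, x)‖ ≤ C₀ M (2/h)ˡ`, a constant depending on `C, b, l` only.

## References

* G. Koch, N. Nadirashvili, G. Seregin, V. Šverák, *Liouville theorems for the Navier–Stokes
  equations and applications*, Acta Math. 203 (2009) 83–105 = arXiv:0709.3599, §4 p. 8,
  Prop. 4.1 with (4.3)–(4.5).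
-/

noncomputable section

open MeasureTheory Filter Topology Set Function
open Literature.Analysis.FluidPDE
open Literature.Analysis.UnboundedOperators (heatExtension)
open scoped Topology NNReal ENNReal

-- Summit = Problem namespace duplication is the tree's layout (CONVENTIONS §1); as in every Theorems file.
set_option linter.dupNamespace false

namespace Summit.NavierStokesRegularity.NavierStokesRegularity.Theorems.ClockLaw.Birth

/-- **Uniform bound on the `l`-th time derivative of Type-I KNSS-mild ancient fields away from
`t = 0`** (KNSS 2009, Prop. 4.1 / (4.5) with `k = 0`, restarted): for every `l`, `C` and `b < 0`
there is `K = K(l, C, b)` with `‖∂ₜˡ u(t, x)‖ ≤ K` for all `u` with `IsTypeIAncientMild C u`, all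
`t ≤ b` and all `x`. The local smooth solution of `knss2009_local_smoothing_holds` from the datum
`u(t - h/2)`, `h = min (ε/M²) (-b/4)`, `M = C/√(-b/2) + 1`, equals `u` near `t`
(`oseenMild_bounded_unique` and continuity of slices), and its weighted bound
`(h/2)ˡ ‖∂ₜˡ v(t, x)‖ ≤ C₀ M` is universal. -/
theorem exists_uniform_bound_iteratedDeriv_slice (l : ℕ) (C b : ℝ) (hb : b < 0) :
    ∃ K : ℝ, ∀ u : ℝ → EuclideanSpace ℝ (Fin 3) → EuclideanSpace ℝ (Fin 3),
      IsTypeIAncientMild C u →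
        ∀ t ≤ b, ∀ x : EuclideanSpace ℝ (Fin 3), ‖iteratedDeriv l (fun τ => u τ x) t‖ ≤ K := by
  obtain ⟨ε, hε, C₀, hC₀, hL⟩ := knss2009_local_smoothing_holds (EuclideanSpace ℝ (Fin 3)) 0 l
  -- the universal sup bound `M` on `(-∞, b/2]` and the universal window length `h`
  set M : ℝ := C / Real.sqrt (-(b / 2)) + 1 with hM
  set h : ℝ := min (ε * 1 / M ^ 2) (-b / 4) with hh
  refine ⟨C₀ * M / (h / 2) ^ l, fun u hu t htb x => ?_⟩
  have hC : 0 ≤ C := hu.nonneg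
  have hCM : 0 ≤ C / Real.sqrt (-(b / 2)) := div_nonneg hC (Real.sqrt_nonneg _)
  have hM0 : 0 < M := by linarith
  have hbdM : ∀ τ ≤ b / 2, ∀ y, ‖u τ y‖ ≤ M := by
    intro τ hτ y
    have hτ0 : τ < 0 := by linarith
    calc ‖u τ y‖ ≤ C / Real.sqrt (-τ) := hu.norm_le hτ0 y
      _ ≤ C / Real.sqrt (-(b / 2)) :=
          div_le_div_of_nonneg_left hC (Real.sqrt_pos.2 (by linarith))
            (Real.sqrt_le_sqrt (by linarith))
      _ ≤ M := by linarith
  have hhε : h ≤ ε * 1 / M ^ 2 := min_le_left _ _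
  have hhb : h ≤ -b / 4 := min_le_right _ _
  have hh0 : 0 < h := lt_min (by positivity) (by linarith)
  -- restart at `s = t - h/2` on the window `(s, T)`, `T = s + h ∋ t`
  set s : ℝ := t - h / 2 with hs
  set T : ℝ := s + h with hT
  have hst : s < t := by linarith
  have htT : t < T := by linarith
  have hTb : T ≤ b / 2 := by linarith
  have hT0 : T < 0 := by linarith
  have hs0 : s < 0 := by linarith
  have hTε : T ≤ s + ε * 1 / M ^ 2 := by linarith
  -- the datum `u s`
  have ha : AEStronglyMeasurable (u s) volume := hu.aestronglyMeasurable_slice hs0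
  have haM : eLpNorm (u s) ∞ volume ≤ ENNReal.ofReal M := by
    rw [eLpNorm_exponent_top]
    exact eLpNormEssSup_le_of_ae_bound (Eventually.of_forall fun y => hbdM s (by linarith) y)
  obtain ⟨v, hvs, hveq, hvM, hvbd⟩ := hL one_pos s hM0 ha haM
  -- uniqueness of bounded solutions on `(s, T)`
  have hmax0 : 0 ≤ max M (C₀ * M) := hM0.le.trans (le_max_left _ _)
  have hum : AEStronglyMeasurable (uncurry u)
      ((volume : Measure (ℝ × EuclideanSpace ℝ (Fin 3))).restrict (Ioo s T ×ˢ univ)) :=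
    hu.aestronglyMeasurable_uncurry hT0.le
  have hvm : AEStronglyMeasurable (uncurry v)
      ((volume : Measure (ℝ × EuclideanSpace ℝ (Fin 3))).restrict (Ioo s T ×ˢ univ)) :=
    (hvs.continuousOn.mono (prod_mono (Ioo_subset_Ioo_right hTε) Subset.rfl)).aestronglyMeasurable
      (measurableSet_Ioo.prod MeasurableSet.univ)
  have huniq : ∀ τ ∈ Ioo s T, u τ =ᵐ[volume] v τ :=
    oseenMild_bounded_unique (ν := 1) (s := s) (T := T) (M := max M (C₀ * M)) (u := u) (v := v)
      (U := fun τ y => heatExtension (u s) (τ - s) y) one_pos hmax0 hum hvm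
      (fun τ hτ y => (hbdM τ (hτ.2.le.trans hTb) y).trans (le_max_left _ _))
      (fun τ hτ y => (hvM τ ⟨hτ.1, hτ.2.trans_le hTε⟩ y).trans (le_max_right _ _))
      (fun τ hτ => Eventually.of_forall fun y => hu.mild_eq_heatExtension hτ.1 (hτ.2.trans hT0) y)
      (fun τ hτ => Eventually.of_forall fun y => by
        have h1 := hveq τ ⟨hτ.1, hτ.2.trans_le hTε⟩ y
        rwa [one_mul] at h1)
  have hueq : ∀ τ ∈ Ioo s T, u τ = v τ := by
    intro τ hτ
    have hcu : Continuous (u τ) := hu.continuous_slice (hτ.2.trans hT0)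
    have hcv : Continuous (v τ) :=
      hvs.continuousOn.comp_continuous (f := fun y => (τ, y)) (by fun_prop)
        fun y => mk_mem_prod ⟨hτ.1, hτ.2.trans_le hTε⟩ (mem_univ _)
    exact (Continuous.ae_eq_iff_eq volume hcu hcv).1 (huniq τ hτ)
  -- the time curves agree near `t`, hence so do their `l`-th derivatives at `t`
  have hev : (fun τ => u τ x) =ᶠ[𝓝 t] fun τ => v τ x := by
    filter_upwards [Ioo_mem_nhds hst htT] with τ hτ
    rw [hueq τ hτ]
  rw [hev.iteratedDeriv_eq l]
  -- the weighted bound (4.5) with `k = 0` at `(t, x)`, `t - s = h/2`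
  have key := hvbd t ⟨hst, htT.trans_le hTε⟩ x
  simp only [norm_iteratedFDeriv_zero, Nat.cast_zero, zero_div, Real.rpow_zero, one_mul] at key
  have hts : t - s = h / 2 := by rw [hs]; ring
  rw [hts] at key
  rw [le_div_iff₀ (pow_pos (half_pos hh0) l), mul_comm]
  exact key

/-- **Stub `stub_timeDerivBounds` (`TimeDerivBounds` of the skeleton): universal window bounds on
`∂ₜu` and `∂ₜ²u`.** For all `C` and `a < b < 0` there is `K` such that every `u` with
`IsTypeIAncientMild C u` satisfies `‖∂ₜu(t,x)‖ ≤ K` and `‖∂ₜ²u(t,x)‖ ≤ K` for `t ∈ [a, b]` and all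
`x` (KNSS 2009, Prop. 4.1 / (4.5) with `(k,l) = (0,1), (0,2)`, through
`exists_uniform_bound_iteratedDeriv_slice`; `timeDeriv u t x = iteratedDeriv 1 (u · x) t`). The
constant depends on `C` and `b` only. -/
theorem stub_timeDerivBounds :
    ∀ (C a b : ℝ), a < b → b < 0 → ∃ K : ℝ,
      ∀ u : ℝ → EuclideanSpace ℝ (Fin 3) → EuclideanSpace ℝ (Fin 3),
        Literature.Analysis.FluidPDE.IsTypeIAncientMild C u →
          ∀ t ∈ Set.Icc a b, ∀ x : EuclideanSpace ℝ (Fin 3),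
            ‖Literature.Analysis.FluidPDE.timeDeriv u t x‖ ≤ K ∧
              ‖iteratedDeriv 2 (fun s : ℝ => u s x) t‖ ≤ K := by
  intro C a b _ hb
  obtain ⟨K₁, hK₁⟩ := exists_uniform_bound_iteratedDeriv_slice 1 C b hb
  obtain ⟨K₂, hK₂⟩ := exists_uniform_bound_iteratedDeriv_slice 2 C b hb
  refine ⟨max K₁ K₂, fun u hu t ht x => ⟨?_, (hK₂ u hu t ht.2 x).trans (le_max_right _ _)⟩⟩
  have h1 := hK₁ u hu t ht.2 x
  rw [iteratedDeriv_one] at h1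
  rw [timeDeriv_apply]
  exact h1.trans (le_max_left _ _)

end Summit.NavierStokesRegularity.NavierStokesRegularity.Theorems.ClockLaw.Birth

end
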